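import Summits.Schanuel.Schanuel.Theorems.RootDecomp1HCyclesInstrument
import Summits.Schanuel.Schanuel.Theorems.RootDecomp1HMirrorClose

/-!
# RootDecomp1H — ROUND 10 «CYCLIC CELLS», part 5 of 5 (§6 heights + the Euclidean certificate EuclExcl ⟹ finCS_cell_of_euclExcl; §7 the node (live closes CALLED); §8 the cell is inhabited)

All parts (`RootDecomp1HCyclesCore` §1+§2a, `RootDecomp1HCyclesRigid` §2b, `RootDecomp1HCyclesCell` §3–§4, `RootDecomp1HCyclesInstrument` §5,
`RootDecomp1HCycles` §6–§8) share the namespace `Summit.Schanuel.Schanuel.Theorems.RootDecomp1HCycles`; importers use `RootDecomp1HCycles`. lens-5 g10 (port rev e 1d5cc529: §6–§7 re-keyed to the Euclidean certificate EuclExcl); `--supports stmt-Schanuel-30564`.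
See part 1 (`RootDecomp1HCyclesCore`) for the account of the round.
-/

set_option linter.dupNamespace false

noncomputable section

namespace Summit.Schanuel.Schanuel.Theorems.RootDecomp1HCycles

open Complex Set
open Literature.NumberTheory.Transcendental (exists_nsmul_mem_span_int mem_adjoin_of_mem_span_int SchanuelRank Khovanskii.ePD)
open Summit.Schanuel.Schanuel.Theses.RootDecomp1H (ProductSchanuel RelTowerSchanuel BridgeTransverse FinCS)
open Summit.Schanuel.Schanuel.Theorems.RootDecomp1HTowerCells (trdeg_adjoin_adjoin_eq trdeg_adjoin_union_le
  trdeg_adjoin_range_le)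
open Summit.Schanuel.Schanuel.Theorems.RootDecomp1HCurveHull
open Summit.Schanuel.Schanuel.Theorems.RootDecomp1HClearance (LowerRanks CounterEx InTowerHull)
open Summit.Schanuel.Schanuel.Theorems.RootDecomp1HWitness
open Summit.Schanuel.Schanuel.Theorems.RootDecomp1HGauge

/-! ## 6. Heights under the cyclic substitution: IMAGE exclusion (the census certificate) ⟹ SOURCE exclusion -/

section height

/-- The `ℓ¹`-NORM of an integer polynomial: the sum of the absolute values of its coefficients. -/
def l1 {σ : Type*} (G : MvPolynomial σ ℤ) : ℕ := G.support.sum fun m => (G.coeff m).natAbs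

variable {σ : Type*}

/-- `(G.coeff m).natAbs ≤ l1 G`. -/
theorem natAbs_coeff_le_l1 (G : MvPolynomial σ ℤ) (m : σ →₀ ℕ) : (G.coeff m).natAbs ≤ l1 G := by
  by_cases hm : m ∈ G.support
  · exact Finset.single_le_sum (f := fun m => (G.coeff m).natAbs) (fun _ _ => Nat.zero_le _) hm
  · rw [MvPolynomial.notMem_support_iff.1 hm]; exact Nat.zero_le _

/-- the ℓ¹-norm of `G` is the sum of |coefficients| over any finset containing its support. -/
theorem l1_eq_sum_of_subset {G : MvPolynomial σ ℤ} {S : Finset (σ →₀ ℕ)} (h : G.support ⊆ S) :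
    l1 G = S.sum fun m => (G.coeff m).natAbs :=
  Finset.sum_subset h fun m _ hm => by simp [MvPolynomial.notMem_support_iff.1 hm]

/-- `l1 (G + H) ≤ l1 G + l1 H`. -/
theorem l1_add_le (G H : MvPolynomial σ ℤ) : l1 (G + H) ≤ l1 G + l1 H := by
  classical
  obtain ⟨S, hS, hGS, hHS⟩ : ∃ S : Finset (σ →₀ ℕ), (G + H).support ⊆ S ∧ G.support ⊆ S ∧ H.support ⊆ S :=
    ⟨_, MvPolynomial.support_add, Finset.subset_union_left, Finset.subset_union_right⟩
  rw [l1_eq_sum_of_subset hS, l1_eq_sum_of_subset hGS, l1_eq_sum_of_subset hHS, ← Finset.sum_add_distrib]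
  exact Finset.sum_le_sum fun m _ => by rw [MvPolynomial.coeff_add]; exact Int.natAbs_add_le _ _

/-- the ℓ¹-norm is subadditive over finite sums. -/
theorem l1_sum_le {ι : Type*} (s : Finset ι) (f : ι → MvPolynomial σ ℤ) :
    l1 (∑ i ∈ s, f i) ≤ ∑ i ∈ s, l1 (f i) := by
  classical
  induction s using Finset.induction_on with
  | empty => simp [l1]
  | @insert a s ha ih =>
    rw [Finset.sum_insert ha, Finset.sum_insert ha]
    exact (l1_add_le _ _).trans (add_le_add le_rfl ih)

/-- `l1 (MvPolynomial.monomial m a) = a.natAbs`. -/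
theorem l1_monomial (m : σ →₀ ℕ) (a : ℤ) : l1 (MvPolynomial.monomial m a) = a.natAbs := by
  classical
  rw [l1, MvPolynomial.support_monomial]
  by_cases ha : a = 0
  · rw [if_pos ha, Finset.sum_empty, ha]; rfl
  · rw [if_neg ha, Finset.sum_singleton, MvPolynomial.coeff_monomial, if_pos rfl]

/-- `l1 (MvPolynomial.C a : MvPolynomial σ ℤ) = a.natAbs`. -/
theorem l1_C (a : ℤ) : l1 (MvPolynomial.C a : MvPolynomial σ ℤ) = a.natAbs := by
  rw [MvPolynomial.C_apply]; exact l1_monomial 0 a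

/-- `l1 (MvPolynomial.X s : MvPolynomial σ ℤ) = 1`. -/
theorem l1_X (s : σ) : l1 (MvPolynomial.X s : MvPolynomial σ ℤ) = 1 := by
  rw [MvPolynomial.X, l1_monomial]; rfl

/-- `l1 (1 : MvPolynomial σ ℤ) = 1`. -/
theorem l1_one : l1 (1 : MvPolynomial σ ℤ) = 1 := by
  rw [← MvPolynomial.C_1, l1_C]; rfl

/-- Submultiplicativity of the `ℓ¹`-norm. -/
theorem l1_mul_le (G H : MvPolynomial σ ℤ) : l1 (G * H) ≤ l1 G * l1 H := by
  classical
  conv_lhs => rw [← MvPolynomial.support_sum_monomial_coeff G, ← MvPolynomial.support_sum_monomial_coeff H,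
    Finset.sum_mul_sum]
  refine (l1_sum_le _ _).trans ?_
  show _ ≤ (G.support.sum fun a => (G.coeff a).natAbs) * (H.support.sum fun b => (H.coeff b).natAbs)
  rw [Finset.sum_mul_sum]
  refine Finset.sum_le_sum fun a _ => (l1_sum_le _ _).trans (Finset.sum_le_sum fun b _ => le_of_eq ?_)
  rw [MvPolynomial.monomial_mul, l1_monomial, Int.natAbs_mul]

/-- `l1 (G ^ k) ≤ l1 G ^ k`. -/
theorem l1_pow_le (G : MvPolynomial σ ℤ) (k : ℕ) : l1 (G ^ k) ≤ l1 G ^ k := by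
  induction k with
  | zero => rw [pow_zero, pow_zero, l1_one]
  | succ k ih => rw [pow_succ, pow_succ]; exact (l1_mul_le _ _).trans (Nat.mul_le_mul ih le_rfl)

/-- the ℓ¹-norm is submultiplicative over finite products. -/
theorem l1_prod_le {ι : Type*} (s : Finset ι) (f : ι → MvPolynomial σ ℤ) :
    l1 (∏ i ∈ s, f i) ≤ ∏ i ∈ s, l1 (f i) := by
  classical
  induction s using Finset.induction_on with
  | empty => rw [Finset.prod_empty, Finset.prod_empty, l1_one]
  | @insert a s ha ih =>
    rw [Finset.prod_insert ha, Finset.prod_insert ha]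
    exact (l1_mul_le _ _).trans (Nat.mul_le_mul le_rfl ih)

/-- A polynomial of total degree `≤ D` in finitely many variables `τ` has at most `(D + 1)^{#τ}` monomials. -/
theorem card_support_le_pow {τ : Type*} [Fintype τ] [DecidableEq τ] (P : MvPolynomial τ ℤ) {D : ℕ}
    (hP : P.totalDegree ≤ D) : P.support.card ≤ (D + 1) ^ Fintype.card τ := by
  classical
  let f : (τ →₀ ℕ) → (τ → Fin (D + 1)) := fun m s => ⟨min (m s) D, by omega⟩
  have hle : ∀ m ∈ P.support, ∀ s, m s ≤ D := fun m hm s =>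
    (MvPolynomial.monomial_le_degreeOf s hm).trans ((MvPolynomial.degreeOf_le_totalDegree P s).trans hP)
  have hinj : Set.InjOn f P.support := by
    intro m hm m' hm' h
    ext s
    have := congrArg (fun g : τ → Fin (D + 1) => ((g s : Fin (D + 1)) : ℕ)) h
    simpa [f, min_eq_left (hle m hm s), min_eq_left (hle m' hm' s)] using this
  calc P.support.card ≤ (Finset.univ : Finset (τ → Fin (D + 1))).card :=
        Finset.card_le_card_of_injOn f (fun _ _ => Finset.mem_coe.2 (Finset.mem_univ _)) hinj
    _ = (D + 1) ^ Fintype.card τ := by simp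

/-- A polynomial of total degree `≤ D` in six variables has at most `(D + 1)⁶` monomials. -/
theorem card_support_le_of_totalDegree_le (P : MvPolynomial (Fin 3 ⊕ Fin 3) ℤ) {D : ℕ} (hP : P.totalDegree ≤ D) :
    P.support.card ≤ (D + 1) ^ 6 := by
  simpa [Fintype.card_sum] using card_support_le_pow P hP

variable {ε c : Fin 3 → ℤ} {y : Fin 3 → ℂ}

/-- The substitution images of the variables have `ℓ¹`-norm `≤ 2` for unit parameters. -/
theorem l1_substFun_le (hp : UnitParams ε c) (s : Fin 3 ⊕ Fin 3) : l1 (substFun ε c s) ≤ 2 := by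
  rcases s with j | j
  · rw [substFun_inl]
    refine (l1_add_le _ _).trans ?_
    have h1 : l1 (MvPolynomial.C (ε (j - 1)) * MvPolynomial.X (j - 1) : MvPolynomial (Fin 3) ℤ) ≤ 1 :=
      (l1_mul_le _ _).trans (by
        rw [l1_C, l1_X, mul_one]
        rcases hp.1 (j - 1) with h | h <;> simp [h])
    have h2 : l1 (MvPolynomial.C (c (j - 1)) : MvPolynomial (Fin 3) ℤ) ≤ 1 := by
      rw [l1_C]; rcases hp.2 (j - 1) with h | h | h <;> simp [h]
    omega
  · rw [substFun_inr, l1_X]; norm_num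

/-- `ℓ¹`-inflation under the cyclic substitution: `‖cycSubst P‖₁ ≤ Σ_d |p_d| · 2^{|d|}`. -/
theorem l1_cycSubst_le (hp : UnitParams ε c) (P : MvPolynomial (Fin 3 ⊕ Fin 3) ℤ) :
    l1 (cycSubst ε c P) ≤ ∑ d ∈ P.support, (P.coeff d).natAbs * 2 ^ (d.sum fun _ e => e) := by
  classical
  rw [cycSubst, MvPolynomial.aeval_eq_eval₂Hom, MvPolynomial.coe_eval₂Hom, MvPolynomial.eval₂_eq']
  refine (l1_sum_le _ _).trans (Finset.sum_le_sum fun d _ => ?_)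
  rw [MvPolynomial.algebraMap_eq]
  refine (l1_mul_le _ _).trans ?_
  rw [l1_C]
  refine Nat.mul_le_mul le_rfl ((l1_prod_le _ _).trans ?_)
  calc ∏ i, l1 (substFun ε c i ^ d i) ≤ ∏ i, 2 ^ d i :=
        Finset.prod_le_prod (fun i _ => Nat.zero_le _) fun i _ =>
          (l1_pow_le _ _).trans (Nat.pow_le_pow_left (l1_substFun_le hp i) _)
    _ = 2 ^ ∑ i, d i := Finset.prod_pow_eq_pow_sum _ _ _
    _ = 2 ^ (d.sum fun _ e => e) := by rw [Finsupp.sum_fintype _ _ (fun _ => rfl)]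

/-- IMAGE EXCLUSION at `u` (the census certificate form, CYCLES31-v1 `EXCL(D, H_cert)`): no non-zero integer polynomial in
`U₀, U₁, U₂` of total degree `≤ D` and height `≤ H` vanishes at `u`. -/
def ImgExcl (u : Fin 3 → ℂ) (D H : ℕ) : Prop :=
  ∀ G : MvPolynomial (Fin 3) ℤ, G.totalDegree ≤ D → (∀ m, (G.coeff m).natAbs ≤ H) → MvPolynomial.aeval u G = 0 → G = 0

/-- **HEIGHT INFLATION IS BOUNDED**: for unit parameters the cyclic image of a size-`≤ 4` integer polynomial has height
`≤ 10⁶` (crude kernel constant: `5⁶` monomials × height `4` × `ℓ¹`-inflation `2⁴`; the sharp constant is `13 440`). -/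
theorem height_cycSubst_le (hp : UnitParams ε c) {P : MvPolynomial (Fin 3 ⊕ Fin 3) ℤ} (hP : psize P ≤ 4)
    (m : Fin 3 →₀ ℕ) : ((cycSubst ε c P).coeff m).natAbs ≤ 1000000 := by
  have hdeg : P.totalDegree ≤ 4 := (le_max_left _ _).trans hP
  have hcoef : ∀ d ∈ P.support, (P.coeff d).natAbs ≤ 4 := fun d hd =>
    (Finset.le_sup (f := fun d => (P.coeff d).natAbs) hd).trans ((le_max_right _ _).trans hP)
  refine (natAbs_coeff_le_l1 _ m).trans ((l1_cycSubst_le hp P).trans ?_)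
  calc ∑ d ∈ P.support, (P.coeff d).natAbs * 2 ^ (d.sum fun _ e => e)
        ≤ ∑ d ∈ P.support, 4 * 2 ^ 4 := Finset.sum_le_sum fun d hd =>
          Nat.mul_le_mul (hcoef d hd) (Nat.pow_le_pow_right (by norm_num) ((MvPolynomial.le_totalDegree hd).trans hdeg))
    _ = P.support.card * (4 * 2 ^ 4) := by rw [Finset.sum_const, smul_eq_mul]
    _ ≤ (4 + 1) ^ 6 * (4 * 2 ^ 4) := Nat.mul_le_mul_right _ (card_support_le_of_totalDegree_le P hdeg)
    _ = 1000000 := by norm_num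

/-- **IMAGE EXCLUSION ⟹ SOURCE EXCLUSION** at size `4`, for any certified height bound `H ≥ 10⁶`
(CYCLES31-v1 certifies `H_cert ≥ 10^{12.5}` at all 105 `ℚ`-free real unit 3-cycles in the ball). -/
theorem srcExcl_of_imgExcl (hp : UnitParams ε c) {u : Fin 3 → ℂ} {H : ℕ} (hH : 1000000 ≤ H) (h : ImgExcl u 4 H) :
    SrcExcl ε c u 4 := fun P hP hval =>
  h _ ((totalDegree_cycSubst_le P).trans ((le_max_left _ _).trans hP))
    (fun m => (height_cycSubst_le hp hP m).trans hH) hval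

/-- **THE LIVE INSTRUMENT AT A CERTIFIED REAL UNIT CYCLE**: the `(3, 1, y)`-instance of `FinCS = FinCSAt stdGauge`
(`stdGauge 3 1 = 4`) follows from the census certificate `ImgExcl (e^y) 4 H`, `H ≥ 10⁶`. -/
theorem finCS_cell_of_imgExcl (h : IsIntCycle ε c y) (hp : UnitParams ε c) {H : ℕ} (hH : 1000000 ≤ H)
    (hex : ImgExcl (cexp ∘ y) 4 H) :
    LowerRanks 3 → NearOpt 3 1 y → ConjStable y →
      (¬ LinearIndependent ℚ y ∨
        ¬ ∃ P : Fin (3 + 1) → MvPolynomial (Fin 3 ⊕ Fin 3) ℤ, (∀ i, psize (P i) ≤ stdGauge 3 1) ∧ IsCertificate 3 y P) :=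
  finCS_cell_of_srcExcl h (g := stdGauge) (srcExcl_of_imgExcl hp hH hex)

/-- … and there the `(3, 1, y)`-instance of the residual `BridgeTransverse = BridgeAt stdGauge` reads EXACTLY
«`LowerRanks 3 →` `y` is not a counterexample». -/
theorem bridge_cell_iff_of_imgExcl (h : IsIntCycle ε c y) (hp : UnitParams ε c) {H : ℕ} (hH : 1000000 ≤ H)
    (hex : ImgExcl (cexp ∘ y) 4 H) (hopt : NearOpt 3 1 y) (hcs : ConjStable y) (hnh : ¬ InTowerHull y) :
    (LowerRanks 3 → NearOpt 3 1 y → ConjStable y → CounterEx y → ¬ InTowerHull y →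
        ∃ P : Fin (3 + 1) → MvPolynomial (Fin 3 ⊕ Fin 3) ℤ, (∀ i, psize (P i) ≤ stdGauge 3 1) ∧ IsCertificate 3 y P) ↔
      (LowerRanks 3 → ¬ CounterEx y) :=
  bridge_cell_iff h (g := stdGauge) (srcExcl_of_imgExcl hp hH hex) hopt hcs hnh

/-- **EUCLIDEAN IMAGE EXCLUSION** — the census certificate LITERALLY (CYCLES31-v1: FLINT-LLL + exact Bareiss Gram–Schmidt
bound `μ ≤ λ₁` ⇒ no non-zero integer relation vector of EUCLIDEAN norm `≤ H_cert` among the monomials of degree `≤ D` at `u`;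
critic's precision note 2026-08-30T12:17:30Z): no non-zero `G ∈ ℤ[U₀,U₁,U₂]` of total degree `≤ D` with `Σ_m (coeff_m G)² ≤ H²`
vanishes at `u`. -/
def EuclExcl (u : Fin 3 → ℂ) (D H : ℕ) : Prop :=
  ∀ G : MvPolynomial (Fin 3) ℤ, G.totalDegree ≤ D → (∑ m ∈ G.support, G.coeff m ^ 2) ≤ (H : ℤ) ^ 2 →
    MvPolynomial.aeval u G = 0 → G = 0

/-- Euclidean ⟹ sup-norm exclusion: `‖m‖₂² ≤ #supp · ‖m‖_∞² ≤ (D+1)³ H²` (crude monomial count; the exact count at `D = 4`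
is `35`). -/
theorem imgExcl_of_euclExcl {u : Fin 3 → ℂ} {D H H₂ : ℕ} (h : EuclExcl u D H₂) (hH : (D + 1) ^ 3 * H ^ 2 ≤ H₂ ^ 2) :
    ImgExcl u D H := fun G hD hcoef hval =>
  h G hD
    (calc ∑ m ∈ G.support, G.coeff m ^ 2 ≤ ∑ m ∈ G.support, (H : ℤ) ^ 2 := Finset.sum_le_sum fun m _ => by
            have h1 : |G.coeff m| ≤ (H : ℤ) := by rw [Int.abs_eq_natAbs]; exact_mod_cast hcoef m
            exact sq_le_sq' (abs_le.1 h1).1 (abs_le.1 h1).2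
      _ = (G.support.card : ℤ) * (H : ℤ) ^ 2 := by rw [Finset.sum_const, nsmul_eq_mul]
      _ ≤ (((D + 1) ^ 3 : ℕ) : ℤ) * (H : ℤ) ^ 2 :=
          mul_le_mul_of_nonneg_right (by exact_mod_cast (card_support_le_pow G hD).trans_eq (by simp)) (sq_nonneg _)
      _ ≤ (H₂ : ℤ) ^ 2 := by exact_mod_cast hH)
    hval

/-- **THE LIVE INSTRUMENT AT A CYCLE FROM THE EUCLIDEAN CERTIFICATE**: `EuclExcl (e^y) 4 H₂` with `H₂ ≥ 11 180 340`
(`125 · 10¹² ≤ H₂²`; CYCLES31-v1 certifies `H₂ = H_cert ≥ 10^{12.5}` at all 105 `ℚ`-free points) gives the `(3, 1, y)`-instance of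
`FinCSAt stdGauge`. -/
theorem finCS_cell_of_euclExcl (h : IsIntCycle ε c y) (hp : UnitParams ε c) {H₂ : ℕ} (hH : 11180340 ≤ H₂)
    (hex : EuclExcl (cexp ∘ y) 4 H₂) :
    LowerRanks 3 → NearOpt 3 1 y → ConjStable y →
      (¬ LinearIndependent ℚ y ∨
        ¬ ∃ P : Fin (3 + 1) → MvPolynomial (Fin 3 ⊕ Fin 3) ℤ, (∀ i, psize (P i) ≤ stdGauge 3 1) ∧ IsCertificate 3 y P) :=
  finCS_cell_of_imgExcl h hp (H := 1000000) le_rfl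
    (imgExcl_of_euclExcl hex ((show (4 + 1) ^ 3 * 1000000 ^ 2 ≤ 11180340 ^ 2 by norm_num).trans (Nat.pow_le_pow_left hH 2)))

/-- … and the residual's exact reading there, from the Euclidean certificate. -/
theorem bridge_cell_iff_of_euclExcl (h : IsIntCycle ε c y) (hp : UnitParams ε c) {H₂ : ℕ} (hH : 11180340 ≤ H₂)
    (hex : EuclExcl (cexp ∘ y) 4 H₂) (hopt : NearOpt 3 1 y) (hcs : ConjStable y) (hnh : ¬ InTowerHull y) :
    (LowerRanks 3 → NearOpt 3 1 y → ConjStable y → CounterEx y → ¬ InTowerHull y →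
        ∃ P : Fin (3 + 1) → MvPolynomial (Fin 3 ⊕ Fin 3) ℤ, (∀ i, psize (P i) ≤ stdGauge 3 1) ∧ IsCertificate 3 y P) ↔
      (LowerRanks 3 → ¬ CounterEx y) :=
  bridge_cell_iff_of_imgExcl h hp (H := 1000000) le_rfl
    (imgExcl_of_euclExcl hex ((show (4 + 1) ^ 3 * 1000000 ^ 2 ≤ 11180340 ^ 2 by norm_num).trans (Nat.pow_le_pow_left hH 2)))
    hopt hcs hnh

end height

/-! ## 7. The node: the live deciding theorem CALLED (item set unchanged) and the cell placed under the route's own binders -/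

section node

open Summit.Schanuel.Schanuel.Theses.RootDecomp1H (StarLocalisation FirstFailureConjStable BridgeCSGlue BridgeCoupledGlue
  BridgeCyclicGlue closes)

/-- **NODE (round 10): the route's deciding theorem `RootDecomp1H.closes`, called** (rev-14 binders) — still closes the
root under the rev-19 `closes` via MirrorItems/MirrorClose (`FirstFailureConjStable ⇒ FirstFailureNearStable`;
`ObliqueLift` PROVED, `obliqueLift_item`); this round adds, splits or restates NO item; it decides the instrument binder
`h₂` on a cell and reads the residual binder `h₅` there. -/
theorem node_closes (h₀ : StarLocalisation) (h₁ : FirstFailureConjStable) (h₂ : FinCS) (h₃ : ProductSchanuel)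
    (h₄ : RelTowerSchanuel) (h₅ : BridgeTransverse) (h₆ : BridgeCSGlue) (h₇ : BridgeCoupledGlue) (h₈ : BridgeCyclicGlue) :
    _root_.Schanuel :=
  closes h₀ (Summit.Schanuel.Schanuel.Theorems.RootDecomp1HMirror.firstFailureNearStable_of_conjStable h₁)
    Summit.Schanuel.Schanuel.Theorems.RootDecomp1HMirror.obliqueLift_item h₂ h₃ h₄ h₅ h₆ h₇ h₈

variable {ε c : Fin 3 → ℤ}

/-- a real integer 3-cycle is an integer 3-cycle in `ℂ`. -/
theorem isIntCycle_ofReal {t : Fin 3 → ℝ} (hcyc : ∀ j, t (j + 1) = ε j * Real.exp (t j) + c j) :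
    IsIntCycle ε c (fun j => (t j : ℂ)) := fun j => by
  simp only [hcyc j, Complex.ofReal_add, Complex.ofReal_mul, Complex.ofReal_intCast, Complex.ofReal_exp]

/-- `ε j ≠ 0`. -/
theorem UnitParams.ne_zero (hp : UnitParams ε c) (j : Fin 3) : ε j ≠ 0 := by
  rcases hp.1 j with h | h <;> simp [h]

/-- **THE CELL NODE.** For unit parameters `ε ∈ {±1}³, c ∈ {−1,0,1}³` and a real solution `t` of the cycle equations with
`|t_j| ≤ 4`, `t₀ + t₁ + t₂ ≠ 0`, carrying the census's EUCLIDEAN certificate `EuclExcl (e^t) 4 H`, `H ≥ 11 180 340`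
(CYCLES31-v1: all 105 `ℚ`-free points, `H = H_cert ≥ 10^{12.5}`):
(a) the LIVE INSTRUMENT instance — binder `h₂ : FinCS = FinCSAt stdGauge` of `closes` at `(3, 1, t)` — HOLDS OUTRIGHT;
(b) under the structural binders `h₃ h₄` of `closes` and `ℚ`-freeness, `t` lies in the residual's domain
    (`NearOpt 3 1 ∧ ConjStable ∧ ¬ InTowerHull`), and
(c) the RESIDUAL instance — binder `h₅ : BridgeTransverse = BridgeAt stdGauge` at `(3, 1, t)` — is EXACTLY
    «`LowerRanks 3 → ¬ CounterEx t`», i.e. Schanuel's conjecture at `t` given the lower ranks. -/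
theorem cell_node (hp : UnitParams ε c) {t : Fin 3 → ℝ} (hcyc : ∀ j, t (j + 1) = ε j * Real.exp (t j) + c j)
    (hball : ∀ j, |t j| ≤ 4) (hsum : t 0 + t 1 + t 2 ≠ 0) {H : ℕ} (hH : 11180340 ≤ H)
    (hex : EuclExcl (cexp ∘ fun j => (t j : ℂ)) 4 H) :
    (LowerRanks 3 → NearOpt 3 1 (fun j => (t j : ℂ)) → ConjStable (fun j => (t j : ℂ)) →
      (¬ LinearIndependent ℚ (fun j => (t j : ℂ)) ∨ ¬ ∃ P : Fin (3 + 1) → MvPolynomial (Fin 3 ⊕ Fin 3) ℤ,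
        (∀ i, psize (P i) ≤ stdGauge 3 1) ∧ IsCertificate 3 (fun j => (t j : ℂ)) P)) ∧
    (ProductSchanuel → RelTowerSchanuel → LinearIndependent ℚ (fun j => (t j : ℂ)) →
      (NearOpt 3 1 (fun j => (t j : ℂ)) ∧ ConjStable (fun j => (t j : ℂ)) ∧ ¬ InTowerHull (fun j => (t j : ℂ))) ∧
      ((LowerRanks 3 → NearOpt 3 1 (fun j => (t j : ℂ)) → ConjStable (fun j => (t j : ℂ)) →
          CounterEx (fun j => (t j : ℂ)) → ¬ InTowerHull (fun j => (t j : ℂ)) →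
            ∃ P : Fin (3 + 1) → MvPolynomial (Fin 3 ⊕ Fin 3) ℤ,
              (∀ i, psize (P i) ≤ stdGauge 3 1) ∧ IsCertificate 3 (fun j => (t j : ℂ)) P) ↔
        (LowerRanks 3 → ¬ CounterEx (fun j => (t j : ℂ))))) := by
  have hint := isIntCycle_ofReal hcyc
  obtain ⟨hopt, hcs⟩ := realUnitCycle_mem_cell hp hcyc hball hsum
  refine ⟨finCS_cell_of_euclExcl hint hp hH hex, fun hPS hRT hli => ?_⟩
  have hnh : ¬ InTowerHull (fun j => (t j : ℂ)) :=
    not_inTowerHull_cycle_of_structural (hint.isCycle hp.ne_zero) hPS hRT hli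
  exact ⟨⟨hopt, hcs, hnh⟩, bridge_cell_iff_of_euclExcl hint hp hH hex hopt hcs hnh⟩

end node

/-! ## 8. The cell is inhabited (kernel): a real unit 3-cycle in the ball, by the intermediate value theorem -/

section inhabited

/-- The unit parameters of census class 1: `ε = (−1, −1, −1)`, `c = (−1, −1, 0)`. -/
def εOne : Fin 3 → ℤ := ![-1, -1, -1]

/-- See `εOne`. -/
def cOne : Fin 3 → ℤ := ![-1, -1, 0]

/-- `UnitParams εOne cOne`. -/
theorem unitParams_one : UnitParams εOne cOne :=
  ⟨fun j => by fin_cases j <;> simp [εOne], fun j => by fin_cases j <;> simp [cOne]⟩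

/-- The return map of the class-1 cycle: `t₀ ↦ −e^{t₂}` where `t₁ = −e^{t₀} − 1`, `t₂ = −e^{t₁} − 1`. -/
def retMap (x : ℝ) : ℝ := -Real.exp (-Real.exp (-Real.exp x - 1) - 1)

/-- `Continuous retMap`. -/
theorem continuous_retMap : Continuous retMap := by
  unfold retMap; fun_prop

/-- `retMap x < 0`. -/
theorem retMap_lt_zero (x : ℝ) : retMap x < 0 :=
  neg_lt_zero.2 (Real.exp_pos _)

/-- `-1 < retMap x`. -/
theorem neg_one_lt_retMap (x : ℝ) : -1 < retMap x := by
  unfold retMap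
  rw [neg_lt_neg_iff, Real.exp_lt_one_iff]
  linarith [Real.exp_pos (-Real.exp x - 1)]

/-- The return map has a fixed point in `[−1, 0]` (intermediate value theorem). -/
theorem exists_fixedPoint_retMap : ∃ x ∈ Set.Icc (-1 : ℝ) 0, retMap x = x := by
  have hc : ContinuousOn (fun x => retMap x - x) (Set.Icc (-1 : ℝ) 0) :=
    (continuous_retMap.sub continuous_id).continuousOn
  have h0 : (0 : ℝ) ∈ Set.Icc (retMap 0 - 0) (retMap (-1) - (-1)) :=
    ⟨by linarith [retMap_lt_zero 0], by linarith [neg_one_lt_retMap (-1)]⟩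
  obtain ⟨x, hx, hx0⟩ := intermediate_value_Icc' (by norm_num) hc h0
  have hx0' : retMap x - x = 0 := hx0
  exact ⟨x, hx, sub_eq_zero.1 hx0'⟩

/-- **THE CELL IS INHABITED** (kernel, no census): a real unit 3-cycle of class `εOne, cOne` exists in the ball `|t_j| ≤ 4`
with `t₀ + t₁ + t₂ ≠ 0` (census class 1: `t ≈ (−0.30837, −1.73465, −1.17646)`). -/
theorem exists_realUnitCycle : ∃ t : Fin 3 → ℝ,
    (∀ j, t (j + 1) = εOne j * Real.exp (t j) + cOne j) ∧ (∀ j, |t j| ≤ 4) ∧ t 0 + t 1 + t 2 ≠ 0 := by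
  obtain ⟨x, ⟨hx1, hx0⟩, hfix⟩ := exists_fixedPoint_retMap
  have hfix' : -Real.exp (-Real.exp (-Real.exp x - 1) - 1) = x := hfix
  have p0 := Real.exp_pos x
  have p1 := Real.exp_pos (-Real.exp x - 1)
  have e0 : Real.exp x ≤ 1 := Real.exp_le_one_iff.2 hx0
  have e1 : Real.exp (-Real.exp x - 1) ≤ 1 := Real.exp_le_one_iff.2 (by linarith)
  refine ⟨![x, -Real.exp x - 1, -Real.exp (-Real.exp x - 1) - 1], ?_, ?_, ?_⟩
  · intro j
    fin_cases j
    · show -Real.exp x - 1 = ((-1 : ℤ) : ℝ) * Real.exp x + ((-1 : ℤ) : ℝ)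
      push_cast; ring
    · show -Real.exp (-Real.exp x - 1) - 1 = ((-1 : ℤ) : ℝ) * Real.exp (-Real.exp x - 1) + ((-1 : ℤ) : ℝ)
      push_cast; ring
    · show x = ((-1 : ℤ) : ℝ) * Real.exp (-Real.exp (-Real.exp x - 1) - 1) + ((0 : ℤ) : ℝ)
      push_cast; linarith
  · intro j
    fin_cases j
    · show |x| ≤ 4
      exact abs_le.2 ⟨by linarith, by linarith⟩
    · show |-Real.exp x - 1| ≤ 4
      exact abs_le.2 ⟨by linarith, by linarith⟩
    · show |-Real.exp (-Real.exp x - 1) - 1| ≤ 4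
      exact abs_le.2 ⟨by linarith, by linarith⟩
  · show x + (-Real.exp x - 1) + (-Real.exp (-Real.exp x - 1) - 1) ≠ 0
    exact ne_of_lt (by linarith)

/-- **CELL `(3, 1)` OF THE INSTRUMENT IS INHABITED BY AN EXPONENTIAL 3-CYCLE** (kernel): there is a real unit 3-cycle `y`
with `NearOpt 3 1 y ∧ ConjStable y` — both inline hypotheses of `FinCS` and the first two of `BridgeTransverse` — which is
moreover off the tower hull under the route's structural binders whenever it is `ℚ`-free. -/
theorem cell_inhabited : ∃ y : Fin 3 → ℂ, IsIntCycle εOne cOne y ∧ NearOpt 3 1 y ∧ ConjStable y ∧ (∀ j, (y j).im = 0) ∧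
    (ProductSchanuel → RelTowerSchanuel → LinearIndependent ℚ y → ¬ InTowerHull y) := by
  obtain ⟨t, hcyc, hball, hsum⟩ := exists_realUnitCycle
  refine ⟨fun j => (t j : ℂ), isIntCycle_ofReal hcyc, (realUnitCycle_mem_cell unitParams_one hcyc hball hsum).1,
    (realUnitCycle_mem_cell unitParams_one hcyc hball hsum).2, fun j => Complex.ofReal_im _, fun hPS hRT hli => ?_⟩
  exact not_inTowerHull_cycle_of_structural ((isIntCycle_ofReal hcyc).isCycle unitParams_one.ne_zero) hPS hRT hli

end inhabited


end Summit.Schanuel.Schanuel.Theorems.RootDecomp1HCycles
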